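import Mathlib
import Literature.Analysis.Calculus.IntervalCauchySchwarz
import Literature.Analysis.PDE.Wave1DSourceEnergy
import HarnessLib

/-!
# Duhamel-type energy bound for `ψ_tt − ψ_xx + V(x)ψ = F` with zero Cauchy data

Analysis/PDE support file (everything proved). For a `C²` solution of the inhomogeneous 1+1 wave
equation with continuous potential `V ≥ 0` and continuous source `F`, having zero Cauchy data on
the base `(a, b)` at time `0`, the energy `E(t) = ∫_{a+t}^{b−t} (ψ_t² + ψ_x² + Vψ²)(t,·)` on the top
of the characteristic trapezoid obeys

  `E(t) ≤ 4 (∫_0^t √(∫_{a+τ}^{b−τ} F(τ,·)²) dτ)²`      (`wave1D_trapezoid_energy_le_of_zero_data`),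

i.e. `√E ≤ 2 ‖F‖_{L¹_t L²_x(trapezoid)}` (the constant `2` instead of `1` buys a Grönwall-free proof:
energy inequality `E(τ) ≤ 2∫_0^τ ∫ ψ_t F` from `Wave1DSourceEnergy.lean`, Cauchy–Schwarz on each
slice (`Literature.Analysis.Calculus.abs_intervalIntegral_mul_le_sqrt`), and the maximum of the
continuous function `E` on `[0, t]`).

Use (route PhotonSphereChannels, `FixedModeChannels`, stmt-FinalStateConjecture-10048): applied to the
difference of the Regge–Wheeler evolution and the free evolution of the same data (source `−Vψ`,
zero data) it bounds the perturbation by `∫_0^∞ sup √V`, exponentially small in the excision radius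
on the horizon side.

References: F. John, *Partial Differential Equations*, 4th ed. (1982), Ch. 5; L. C. Evans, *Partial
Differential Equations*, 2nd ed. (2010), §2.4.3. Standard; folklore.
-/

noncomputable section

namespace Literature.Analysis.PDE

open MeasureTheory Set Filter Topology intervalIntegral Literature.Analysis.Calculus

/-! ### The Duhamel-type energy bound for zero Cauchy data -/

section ZeroData

variable {V : ℝ → ℝ} {F ψ : ℝ → ℝ → ℝ}

/-- **Energy bound for the inhomogeneous equation with zero data.** Let `ψ` (`C²`) solve
`ψ_tt − ψ_xx + V(x)ψ = F` with continuous `V ≥ 0`, `F`, and have zero Cauchy data on `(a, b)` at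
time `0` (`ψ(0,x) = 0`, `ψ_t(0,x) = 0`). Then for `0 ≤ t` with `a + t ≤ b − t`, the energy on the top
of the trapezoid is controlled by the `L¹_t L²_x` norm of the source over the trapezoid:
`∫_{a+t}^{b−t} e(t,·) ≤ 4 (∫_0^t √(∫_{a+τ}^{b−τ} F(τ,·)²) dτ)²`. Proof: the energy inequality,
Cauchy–Schwarz on each slice, and the maximum of the (continuous) energy over `[0, t]`. [folklore] -/
theorem wave1D_trapezoid_energy_le_of_zero_data (hV : Continuous V) (hV0 : ∀ x, 0 ≤ V x)
    (hF : Continuous (Function.uncurry F)) (hψ : ContDiff ℝ 2 (Function.uncurry ψ))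
    (hsol : ∀ t x, iteratedDeriv 2 (fun τ => ψ τ x) t - iteratedDeriv 2 (ψ t) x + V x * ψ t x
      = F t x)
    {a b : ℝ} (hzero : ∀ x ∈ Ioo a b, ψ 0 x = 0 ∧ deriv (fun τ => ψ τ x) 0 = 0)
    {t : ℝ} (ht : 0 ≤ t) (hab : a + t ≤ b - t) :
    (∫ x in (a + t)..(b - t),
        (deriv (fun τ => ψ τ x) t ^ 2 + deriv (ψ t) x ^ 2 + V x * ψ t x ^ 2))
      ≤ 4 * (∫ τ in (0 : ℝ)..t, Real.sqrt (∫ x in (a + τ)..(b - τ), F τ x ^ 2)) ^ 2 := by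
  obtain ⟨ψt, ψx, ψtt, ψtx, ψxx, hct, hcx, -, -, -, h1, h2, -⟩ := exists_partials_of_contDiff_two hψ
  have hd1 : ∀ t x, deriv (fun τ => ψ τ x) t = ψt t x := fun t x => (h1 t x).deriv
  have hd2 : ∀ t x, deriv (ψ t) x = ψx t x := fun t x => (h2 t x).deriv
  -- the energy and the source norm as continuous functions of time
  set E : ℝ → ℝ := fun τ => ∫ x in (a + τ)..(b - τ),
    (deriv (fun σ => ψ σ x) τ ^ 2 + deriv (ψ τ) x ^ 2 + V x * ψ τ x ^ 2) with hE
  set k : ℝ → ℝ := fun τ => Real.sqrt (∫ x in (a + τ)..(b - τ), F τ x ^ 2) with hk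
  have he_cont : Continuous (Function.uncurry fun τ x =>
      deriv (fun σ => ψ σ x) τ ^ 2 + deriv (ψ τ) x ^ 2 + V x * ψ τ x ^ 2) :=
    continuous_wave1D_energyDensity hV hψ
  have hcont2 : ∀ {φ : ℝ → ℝ → ℝ}, Continuous (Function.uncurry φ) →
      ∀ {u v : ℝ → ℝ}, Continuous u → Continuous v → Continuous fun y => φ (u y) (v y) :=
    fun hφ u v hu hv => hφ.comp (hu.prodMk hv)
  -- joint continuity of parametric primitives gives continuity of `E` and `k`
  have hparam : ∀ {φ : ℝ → ℝ → ℝ}, Continuous (Function.uncurry φ) →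
      Continuous fun τ => ∫ x in (a + τ)..(b - τ), φ τ x := by
    intro φ hφ
    have hP := intervalIntegral.continuous_parametric_primitive_of_continuous (μ := volume)
      (a₀ := (0 : ℝ)) hφ
    have c1 : Continuous fun τ : ℝ => ∫ x in (0 : ℝ)..(b - τ), φ τ x :=
      hP.comp (continuous_id.prodMk (continuous_const.sub continuous_id))
    have c2 : Continuous fun τ : ℝ => ∫ x in (0 : ℝ)..(a + τ), φ τ x :=
      hP.comp (continuous_id.prodMk (continuous_const.add continuous_id))
    have heq : (fun τ => ∫ x in (a + τ)..(b - τ), φ τ x)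
        = fun τ => (∫ x in (0 : ℝ)..(b - τ), φ τ x) - ∫ x in (0 : ℝ)..(a + τ), φ τ x := by
      funext τ
      have i1 : IntervalIntegrable (fun x => φ τ x) volume 0 (b - τ) :=
        (hcont2 hφ continuous_const continuous_id).intervalIntegrable _ _
      have i2 : IntervalIntegrable (fun x => φ τ x) volume 0 (a + τ) :=
        (hcont2 hφ continuous_const continuous_id).intervalIntegrable _ _
      exact (integral_interval_sub_left i1 i2).symm
    rw [heq]
    exact c1.sub c2
  have hE_cont : Continuous E := hparam he_cont
  have hF2_cont : Continuous (Function.uncurry fun τ x => F τ x ^ 2) := by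
    show Continuous fun p : ℝ × ℝ => F p.1 p.2 ^ 2
    have : Continuous fun p : ℝ × ℝ => F p.1 p.2 := hF
    fun_prop
  have hk_cont : Continuous k := Real.continuous_sqrt.comp (hparam hF2_cont)
  have hk0 : ∀ τ, 0 ≤ k τ := fun τ => Real.sqrt_nonneg _
  -- `E 0 = 0`
  have hab0 : a ≤ b := by linarith
  have hE0 : E 0 = 0 := by
    simp only [hE, add_zero, sub_zero]
    rw [integral_of_le hab0, integral_Ioc_eq_integral_Ioo,
      setIntegral_congr_fun measurableSet_Ioo (g := fun _ => (0 : ℝ)) ?_]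
    · simp
    · intro x hx
      obtain ⟨h0, h0'⟩ := hzero x hx
      have hx' : deriv (ψ 0) x = 0 := by
        have hev : (ψ 0) =ᶠ[𝓝 x] fun _ => 0 :=
          Filter.mem_of_superset (Ioo_mem_nhds hx.1 hx.2) fun y hy => (hzero y hy).1
        rw [hev.deriv_eq, deriv_const]
      simp only [h0, h0', hx']
      ring
  -- the energy inequality from `0` to `τ ∈ [0, t]`, with Cauchy–Schwarz on the slices
  have hstep : ∀ τ ∈ Icc 0 t, E τ ≤ 2 * ∫ σ in (0 : ℝ)..τ, Real.sqrt (E σ) * k σ := by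
    intro τ hτ
    have hτab : a + τ ≤ b - τ := by linarith [hτ.2]
    have h := wave1D_trapezoid_energy_sub_le_source hV hV0 hF hψ hsol hτ.1 hτab
    simp only [add_zero, sub_zero] at h
    have hE0' : (∫ x in a..b, (deriv (fun τ => ψ τ x) 0 ^ 2 + deriv (ψ 0) x ^ 2 + V x * ψ 0 x ^ 2))
        = 0 := by simpa [hE] using hE0
    rw [hE0', sub_zero] at h
    refine h.trans ?_
    rw [mul_le_mul_iff_of_pos_left (by norm_num : (0 : ℝ) < 2)]
    refine intervalIntegral.integral_mono_on hτ.1 ?_ ?_ fun σ hσ => ?_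
    · exact (hparam (by
        show Continuous fun p : ℝ × ℝ => deriv (fun σ' => ψ σ' p.2) p.1 * F p.1 p.2
        simp only [hd1]
        have ha : Continuous fun p : ℝ × ℝ => ψt p.1 p.2 := hct
        have hb : Continuous fun p : ℝ × ℝ => F p.1 p.2 := hF
        fun_prop)).intervalIntegrable _ _
    · exact ((Real.continuous_sqrt.comp hE_cont).mul hk_cont).intervalIntegrable _ _
    · have hσab : a + σ ≤ b - σ := by linarith [hσ.2, hτ.2]
      have hcs := abs_intervalIntegral_mul_le_sqrt (f := fun x => deriv (fun σ' => ψ σ' x) σ)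
        (g := fun x => F σ x) (by simp only [hd1]; exact hcont2 hct continuous_const continuous_id)
        (hcont2 hF continuous_const continuous_id) hσab
      refine (le_abs_self _).trans (hcs.trans ?_)
      refine mul_le_mul_of_nonneg_right (Real.sqrt_le_sqrt ?_) (hk0 σ)
      -- `∫ ψ_t² ≤ E σ`
      refine intervalIntegral.integral_mono_on hσab ?_ ?_ fun x _ => ?_
      · exact ((by simp only [hd1]; exact hcont2 hct continuous_const continuous_id :
          Continuous fun x => deriv (fun σ' => ψ σ' x) σ).pow 2).intervalIntegrable _ _
      · exact (hcont2 he_cont continuous_const continuous_id).intervalIntegrable _ _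
      · have := hV0 x
        nlinarith [sq_nonneg (deriv (ψ σ) x), mul_nonneg this (sq_nonneg (ψ σ x))]
  -- maximum of `E` on `[0, t]`
  obtain ⟨τ₀, hτ₀, hmax⟩ := isCompact_Icc.exists_isMaxOn (nonempty_Icc.2 ht) hE_cont.continuousOn
  set Mx : ℝ := E τ₀ with hMx
  have hEle : ∀ τ ∈ Icc 0 t, E τ ≤ Mx := fun τ hτ => hmax hτ
  have hM0 : 0 ≤ Mx := by rw [hMx, ← hE0]; exact hEle 0 ⟨le_rfl, ht⟩
  set K : ℝ := ∫ τ in (0 : ℝ)..t, k τ with hK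
  have hKmono : (∫ σ in (0 : ℝ)..τ₀, k σ) ≤ K :=
    intervalIntegral.integral_mono_interval le_rfl hτ₀.1 hτ₀.2 (Eventually.of_forall hk0)
      (hk_cont.intervalIntegrable _ _)
  have hK0 : 0 ≤ K := intervalIntegral.integral_nonneg ht fun τ _ => hk0 τ
  -- `Mx ≤ 2 √Mx K`
  have hkey : Mx ≤ 2 * (Real.sqrt Mx * K) := by
    have h := hstep τ₀ hτ₀
    have h2 : (∫ σ in (0 : ℝ)..τ₀, Real.sqrt (E σ) * k σ) ≤ ∫ σ in (0 : ℝ)..τ₀, Real.sqrt Mx * k σ := by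
      refine intervalIntegral.integral_mono_on hτ₀.1
        (((Real.continuous_sqrt.comp hE_cont).mul hk_cont).intervalIntegrable _ _)
        ((continuous_const.mul hk_cont).intervalIntegrable _ _) fun σ hσ => ?_
      exact mul_le_mul_of_nonneg_right (Real.sqrt_le_sqrt (hEle σ ⟨hσ.1, hσ.2.trans hτ₀.2⟩))
        (hk0 σ)
    rw [intervalIntegral.integral_const_mul] at h2
    nlinarith [Real.sqrt_nonneg Mx]
  have hsqrt : Real.sqrt Mx ≤ 2 * K := by
    rcases le_or_gt (Real.sqrt Mx) (2 * K) with hc | hc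
    · exact hc
    · have hs0 : 0 < Real.sqrt Mx := lt_of_le_of_lt (by positivity) hc
      have : Mx = Real.sqrt Mx * Real.sqrt Mx := (Real.mul_self_sqrt hM0).symm
      nlinarith
  have hMle : Mx ≤ 4 * K ^ 2 := by
    calc Mx = Real.sqrt Mx ^ 2 := (Real.sq_sqrt hM0).symm
      _ ≤ (2 * K) ^ 2 := pow_le_pow_left₀ (Real.sqrt_nonneg _) hsqrt 2
      _ = 4 * K ^ 2 := by ring
  exact (hEle t ⟨ht, le_rfl⟩).trans hMle

end ZeroData

end Literature.Analysis.PDE
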